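import Summits.BirchSwinnertonDyer.BirchSwinnertonDyer.Theorems.AlignedTransportAtTwoMainConjectureOfRankZeroBSDAtTwoTwistSaturationLValue
import HarnessLib

/-!
# Route `AlignedTransportAtTwo`, crux C2 `MainConjectureOfRankZeroBSDAtTwo` (stmt-BirchSwinnertonDyer-22298):
# THE SELMER-CORANK FORM OF THE TWIST-SATURATION DOOR AND THE PARITY DICHOTOMY — on a weight-`2` seed with EVEN `corank_{ℤ₂} Sel_{2^∞}(W⁽²⁾/ℚ)`:
# EITHER `μ(X(W/ℚ_∞)) = 0` OR `Sel_{2^∞}(W⁽²⁾/ℚ)` has corank `0`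

HONEST FRAMING (cell `bsd-f1-sign2`, WIDTH-5 attached prover seat `bsd-line-att-p5` gen 46 on line `birth` of the lead `bsd-line-att-p2`;
`--supports` stmt-BirchSwinnertonDyer-22298, closes nothing; BSD is NOT proved by any of this; the crux C2, its verdict «blocked-on
`Rank1Residual.GreenbergMuConjectureIrreducible`» and every registered stub are untouched). THEOREMS ONLY — no `def`, no instance, no named fact, no `sorry`.

Sequel of `…TwistSaturation` (p811907) / `…TwistSaturationLValue` (p812157). p811907's Selmer form `corank Sel_{2^∞}(W⁽²⁾/ℚ) + μ + 2t ≤ v + 2e + s` lets the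
DIVISIBLE part of `Ш(W⁽²⁾/ℚ)[2^∞]` pay for the weight instead of rational points. Two consequences:

* ★★ `mu_eq_zero_of_le_selmerCorank_twist` (datum level, UNCONDITIONAL): corank-saturation `v + 2e + s ≤ corank Sel_{2^∞}(W₂/ℚ) + 2t` ⟹ `μ = 0`,
  `λ = corank`, `char X = ((T+2)^{corank})`; `forall_mu_eq_zero_of_le_selmerCorank_twist` (datum-free).
* ★★★ `mu_eq_zero_or_selmerCorank_twist_eq_zero_of_even` — THE PARITY DICHOTOMY on a WEIGHT-`2` seed (`v + 2e + s = 2t + 2`, e.g. `a₂ = +1`, `∏c` odd, `Ш(W)[2] = 0`,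
  `E(ℚ)[2] = 0`): if `corank_{ℤ₂} Sel_{2^∞}(W⁽²⁾/ℚ)` is EVEN (the displayed binder `hpar`; on `N ≡ ±1 (mod 8)` this is the 2-parity theorem with `w(W⁽²⁾) = w(W) = +1`,
  supplied by the consumer) then **`μ(X(W/ℚ_∞)) = 0 ∨ corank_{ℤ₂} Sel_{2^∞}(W⁽²⁾/ℚ) = 0`**: a counterexample to Greenberg's `μ`-conjecture at `2` on this habitat has a
  `√2`-twist with FINITE `2^∞`-Selmer group (hence rank `0` and finite `Ш[2^∞]`); `…_of_lValue` — the same in the cell's `L`-value currency.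

References: R. Greenberg, LNM 1716 (1999), Thm. 1.9, §3 L.3.1, Thm. 4.1, §4 p. 107 [GreenbergLNM1716]; T. and V. Dokchitser, Ann. of Math. 172 (2010), Thm. 1.4
[DokchitserDokchitserAnnals2010]; P. Monsky, Math. Z. 221 (1996) [Monsky1996]; R. L. Miller, LMS J. Comput. Math. 14 (2011), Def. 1.1 [Miller2011LMS].
-/

set_option linter.dupNamespace false
set_option autoImplicit false

noncomputable section

open scoped Classical

namespace Summit.BirchSwinnertonDyer.BirchSwinnertonDyer.Theorems.AlignedTransportAtTwoTwistSaturation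

open PowerSeries WeierstrassCurve Literature.NumberTheory.EllipticCurves
  Literature.NumberTheory.EllipticCurves.Rank1Residual
  Literature.NumberTheory.EllipticCurves.Greenberg1999
  Literature.NumberTheory.EllipticCurves.Module
  Literature.NumberTheory.EllipticCurves.IwasawaAlgebra
  Summit.BirchSwinnertonDyer.Rank1Residual
  Summit.BirchSwinnertonDyer.Rank1Residual.X1.MuLambda
  Summit.BirchSwinnertonDyer.Rank1Residual.X1.MuPart
  Summit.BirchSwinnertonDyer.Rank1Residual.X1.ParitySqueeze
  Summit.BirchSwinnertonDyer.Rank1Residual.X5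
  Summit.BirchSwinnertonDyer.Rank1Residual.Iwasawa
  Summit.BirchSwinnertonDyer.BirchSwinnertonDyer.Theorems.Rank1ResidualX1Defs
  Summit.BirchSwinnertonDyer.BirchSwinnertonDyer.Theorems.AlignedTransportAtTwoEisensteinRigidityConservation
  Summit.BirchSwinnertonDyer.BirchSwinnertonDyer.Theorems.AlignedTransportAtTwoTwistReading
  Summit.BirchSwinnertonDyer.BirchSwinnertonDyer.Theorems.AlignedTransportAtTwoCyclotomicLayerWeightEuler
  Summit.BirchSwinnertonDyer.BirchSwinnertonDyer.Theorems.TwoAdicEulerCharKernel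
  Summit.BirchSwinnertonDyer.BirchSwinnertonDyer.Theorems.AlignedTransportAtTwoSelmerTwoOfBSDp
  Summit.BirchSwinnertonDyer.BirchSwinnertonDyer.Theorems.InputsGreenbergCharValue

section Datum

variable (κ : ZpExtension ℚ 2) (hκ : κ.IsCyclotomic) {γ : Field.absoluteGaloisGroup ℚ} (hγ : κ.IsTopGenerator γ)
  (hγ' : IsCyclotomicVariable 2 γ)
  (W W₂ : WeierstrassCurve ℚ) [W.IsElliptic] [W.IsGloballyMinimal] [W₂.IsElliptic] {V : VariableChange ℚ}
  (hV : V • W₂ = W.quadraticTwist 2)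

include hκ hγ hγ' hV in
/-- ★★ **THE SELMER-CORANK DOOR, datum level, UNCONDITIONAL.** Hypotheses of p811907's door with the Mordell–Weil rank of the twist replaced by the
`ℤ₂`-corank of `Sel_{2^∞}(W₂/ℚ)`: corank-saturation `v + 2e + s ≤ corank_{ℤ₂} Sel_{2^∞}(W₂/ℚ) + 2t` ⟹ **`μ(X(W/ℚ_∞)) = 0`, `λ = corank`,
`char_Λ X(W/ℚ_∞) = ((T+2)^{corank})`** (g38's `(T+2)^{corank} ∣ f_X`, Greenberg's Lemma 3.1 for the twist, in place of Thm. 1.9).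
[cite: GreenbergLNM1716, §3 Lemma 3.1 (p. 86), Thm. 4.1 (p. 102), §4 p. 107] -/
theorem mu_eq_zero_of_le_selmerCorank_twist (hord : IsOrdinaryAt W 2) (D : W.SelmerDualData κ γ)
    (hfin : Finite (W.selmerGroupPInfty 2)) {t e s : ℕ}
    (ht : Nat.card (AddCommGroup.primaryComponent W.toAffine.Point 2) = 2 ^ t)
    (he : Nat.card (AddCommGroup.primaryComponent ((integralModelInt W).map (Int.castRingHom (ZMod 2))).toAffine.Point 2) = 2 ^ e)
    (hs : Nat.card (W.selmerGroupPInfty 2) = 2 ^ s)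
    (hsat : padicValNat 2 W.tamagawaProduct + 2 * e + s ≤ W₂.selmerCorank 2 + 2 * t) :
    D.mu = 0 ∧ D.lambda = W₂.selmerCorank 2 ∧
      D.charIdeal = Ideal.span {(X + C (2 : ℤ_[2])) ^ (W₂.selmerCorank 2)} := by
  haveI : Module.Finite (IwasawaAlgebra 2) D.X := D.module_finite_holds hγ
  haveI : (charIdeal (IwasawaAlgebra 2) D.X).IsPrincipal := charIdeal_isPrincipal_holds 2 D.X
  obtain ⟨fX, hfX⟩ := Submodule.IsPrincipal.principal (charIdeal (IwasawaAlgebra 2) D.X)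
  have hchar : D.charIdeal = Ideal.span {fX} := hfX
  have hD : D.IsTorsion := isTorsion_of_finite κ hκ hγ W hord D hfin
  obtain ⟨hineq, hnorm⟩ := norm_constantCoeff_charGen_eq_of_thm41 W thm41_charValue_rankZero_anyPrime_holds
    ((isOrdinaryAt_iff W 2).mp hord).1 ((isOrdinaryAt_iff W 2).mp hord).2 hκ hγ hγ' D hD hchar hfin ht he hs
  have hdvd := X_add_C_two_pow_selmerCorank_twist_dvd_charGen κ hκ hγ W W₂ hV D hD hchar
  have hle := mu_add_le_of_X_add_C_two_pow_dvd hdvd hnorm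
  have hw : padicValNat 2 W.tamagawaProduct + 2 * e + s - 2 * t = W₂.selmerCorank 2 := by omega
  rw [hw] at hnorm
  have hfX0 : constantCoeff fX ≠ 0 := by
    intro h0
    rw [h0, norm_zero] at hnorm
    exact (pow_ne_zero _ (by norm_num : ((2 : ℝ)⁻¹) ≠ 0)) hnorm.symm
  have hfXne : fX ≠ 0 := fun h0 => hfX0 (by rw [h0, map_zero])
  have hmufX : mu fX = D.mu := mu_generator_eq_muInvariant D.X hD hfXne hchar
  have hlamfX : lam fX = D.lambda := lam_generator_eq_lambdaInvariant D.X hD hfXne hchar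
  obtain ⟨hmu0, hlam0⟩ := mu_eq_zero_and_lam_eq_of_X_add_C_two_pow_dvd hdvd hnorm
  refine ⟨by rw [← hmufX, hmu0], by rw [← hlamfX, hlam0], ?_⟩
  rw [hchar]
  exact Ideal.span_singleton_eq_span_singleton.mpr (associated_X_add_C_two_pow_of_dvd hdvd hnorm).symm

include hκ hγ hγ' hV in
/-- ★★★ **THE PARITY DICHOTOMY ON A WEIGHT-`2` SEED, datum level.** `W/ℚ` globally minimal, good ordinary at `2`, `Sel_{2^∞}(W/ℚ)` finite, with WEIGHT `2`:
`v + 2e + s = 2t + 2` (e.g. `E(ℚ)[2] = 0`, `a₂ = +1`, `∏c_ℓ` odd, `Ш(W/ℚ)[2] = 0`); `W₂` a `ℚ`-model of `W⁽²⁾` whose `2^∞`-Selmer corank is EVEN (`hpar`). Then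
**`μ(X(W/ℚ_∞)) = 0 ∨ corank_{ℤ₂} Sel_{2^∞}(W₂/ℚ) = 0`**: `corank + μ ≤ 2` (p811907) and `corank ∈ {0, 2, 4, …}`. UNCONDITIONAL given `hpar`.
[cite: GreenbergLNM1716, §3 Lemma 3.1 (p. 86), Thm. 4.1 (p. 102), §4 p. 107] [cite: DokchitserDokchitserAnnals2010, Thm. 1.4] -/
theorem mu_eq_zero_or_selmerCorank_twist_eq_zero_of_even (hord : IsOrdinaryAt W 2) (D : W.SelmerDualData κ γ)
    (hfin : Finite (W.selmerGroupPInfty 2)) {t e s : ℕ}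
    (ht : Nat.card (AddCommGroup.primaryComponent W.toAffine.Point 2) = 2 ^ t)
    (he : Nat.card (AddCommGroup.primaryComponent ((integralModelInt W).map (Int.castRingHom (ZMod 2))).toAffine.Point 2) = 2 ^ e)
    (hs : Nat.card (W.selmerGroupPInfty 2) = 2 ^ s)
    (hw : padicValNat 2 W.tamagawaProduct + 2 * e + s = 2 * t + 2) (hpar : Even (W₂.selmerCorank 2)) :
    D.mu = 0 ∨ W₂.selmerCorank 2 = 0 := by
  have hle := selmerCorank_twist_add_mu_add_le κ hκ hγ hγ' W W₂ hV hord D hfin ht he hs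
  obtain ⟨k, hk⟩ := hpar
  rcases Nat.eq_zero_or_pos k with h0 | hpos
  · right; omega
  · left
    exact (mu_eq_zero_of_le_selmerCorank_twist κ hκ hγ hγ' W W₂ hV hord D hfin ht he hs (by omega)).1

end Datum

section Cell

variable (W W₂ : WeierstrassCurve ℚ) [W.IsElliptic] [W.IsGloballyMinimal] [W₂.IsElliptic] {V : VariableChange ℚ}
  (hV : V • W₂ = W.quadraticTwist 2)

include hV in
/-- ★★ **The Selmer-corank door, datum-free**: corank-saturation ⟹ `μ = 0` (and `λ = corank`, `char X = ((T+2)^{corank})`) at every normalised cyclotomic datum.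
[cite: GreenbergLNM1716, §3 Lemma 3.1 (p. 86), Thm. 4.1 (p. 102), §4 p. 107] -/
theorem forall_mu_eq_zero_of_le_selmerCorank_twist (hord : IsOrdinaryAt W 2) (hfin : Finite (W.selmerGroupPInfty 2))
    {t e s : ℕ} (ht : Nat.card (AddCommGroup.primaryComponent W.toAffine.Point 2) = 2 ^ t)
    (he : Nat.card (AddCommGroup.primaryComponent ((integralModelInt W).map (Int.castRingHom (ZMod 2))).toAffine.Point 2) = 2 ^ e)
    (hs : Nat.card (W.selmerGroupPInfty 2) = 2 ^ s)
    (hsat : padicValNat 2 W.tamagawaProduct + 2 * e + s ≤ W₂.selmerCorank 2 + 2 * t) :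
    ∀ (κ : ZpExtension ℚ 2) (γ : Field.absoluteGaloisGroup ℚ), κ.IsCyclotomic → κ.IsTopGenerator γ →
      IsCyclotomicVariable 2 γ → ∀ D : W.SelmerDualData κ γ,
        D.mu = 0 ∧ D.lambda = W₂.selmerCorank 2 ∧ D.charIdeal = Ideal.span {(X + C (2 : ℤ_[2])) ^ (W₂.selmerCorank 2)} :=
  fun κ _ hκ hγ hγ' D => mu_eq_zero_of_le_selmerCorank_twist κ hκ hγ hγ' W W₂ hV hord D hfin ht he hs hsat

include hV in
/-- ★★★ **THE PARITY DICHOTOMY IN THE CELL'S CURRENCY.** `W` globally minimal, good ordinary at `2` with `a₂ = +1` (`#Ẽ(𝔽₂) = 2`), no rational point of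
order `2`, `r_an(W) = 0`, `BSD(W,2)`, `∏c_ℓ` odd, `L(W,1)/Ω_W = q` (`q ≠ 0`, `ord₂ q = 0`), GZK; `W₂` a `ℚ`-model of `W⁽²⁾` with EVEN `corank_{ℤ₂} Sel_{2^∞}(W₂/ℚ)`
(`hpar`: the 2-parity theorem with `w(W⁽²⁾) = w(W) = +1` on `N ≡ ±1 (mod 8)`, supplied by the consumer). Then for EVERY normalised cyclotomic dual datum:
**`μ(X(W/ℚ_∞)) = 0 ∨ corank_{ℤ₂} Sel_{2^∞}(W₂/ℚ) = 0`** — a seed of this habitat violating Greenberg's `μ`-conjecture at `2` has a `√2`-twist of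
`2^∞`-Selmer corank `0`. [cite: GreenbergLNM1716, Thm. 4.1 (p. 102), §4 p. 107] [cite: DokchitserDokchitserAnnals2010, Thm. 1.4] [cite: Miller2011LMS, Def. 1.1] -/
theorem mu_eq_zero_or_selmerCorank_twist_eq_zero_of_lValue_of_even (hGZK : rank_eq_analyticRank_of_analyticRank_le_one)
    (hord : IsOrdinaryAt W 2) (ha : W.reductionPointCount 2 = 2) (ht : ∀ x : ℚ, ¬ HasRationalTwoTorsionX W x) (hr : W.analyticRank = 0)
    (hbsd : BSDp W 2) (htam : Odd W.tamagawaProduct)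
    (hL : ∃ q : ℚ, q ≠ 0 ∧ W.entireLFunction 1 / (W.realPeriodRat : ℂ) = (q : ℂ) ∧ padicValRat 2 q = 0)
    (hpar : Even (W₂.selmerCorank 2))
    (κ : ZpExtension ℚ 2) {γ : Field.absoluteGaloisGroup ℚ} (hκ : κ.IsCyclotomic) (hγ : κ.IsTopGenerator γ)
    (hγ' : IsCyclotomicVariable 2 γ) (D : W.SelmerDualData κ γ) :
    D.mu = 0 ∨ W₂.selmerCorank 2 = 0 := by
  have hfin : Finite (W.selmerGroupPInfty 2) := finite_selmerGroupPInfty_two_of_analyticRank_eq_zero W hGZK hr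
  have ht0 : Nat.card (AddCommGroup.primaryComponent W.toAffine.Point 2) = 2 ^ 0 := by
    rw [pow_zero]; exact natCard_primaryComponent_point_two_eq_one W ht
  have he := natCard_primaryComponent_reduction_eq_pow W 2
  rw [ha, padicValNat_self] at he
  have hs : Nat.card (W.selmerGroupPInfty 2) = 2 ^ 0 := by
    rw [pow_zero]; exact natCard_selmerGroupPInfty_two_eq_one_of_bsdp_of_lValue W ht hr hbsd htam hL
  have hv : padicValNat 2 W.tamagawaProduct = 0 :=
    padicValNat.eq_zero_of_not_dvd (AlignedTransportAtTwoSelmerTwoOfBSDp.not_two_dvd_tamagawaProduct_of_odd W htam)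
  exact mu_eq_zero_or_selmerCorank_twist_eq_zero_of_even κ hκ hγ hγ' W W₂ hV hord D hfin ht0 he hs (by rw [hv]) hpar

end Cell

end Summit.BirchSwinnertonDyer.BirchSwinnertonDyer.Theorems.AlignedTransportAtTwoTwistSaturation

end
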